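import Literature.NumberTheory.Automorphic.GKContragredientFunctor
import HarnessLib

/-!
# Equivalent `(𝔤, K)`-modules have equivalent `K`-finite contragredients: `V ≅ W ⟹ Ṽ ≅ W̃`

Family `hodge`, lane `lit-hodgefound` (foundations library; seat `lit-hodgefound-p39`, generation 31, row g31-#13); topic
`NumberTheory/Automorphic` (next to `GKContragredient`, `GKContragredientFunctor`), namespace `Literature.NumberTheory.Automorphic.GKDual`.
One definition with body + theorems; 0 `sorry`, no named fact (net debt 0, D-0026).

`GKContragredientFunctor` transports the FULL-dual data along a `(𝔤, K)`-equivalence `e : V ≅ W` (`GKEquiv.dualEquiv e : V* ≅ W*`,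
`ℓ ↦ ℓ ∘ e⁻¹`).  Since `ℓ ↦ ℓ ∘ e⁻¹` intertwines the contragredient `K`-actions, it carries `K`-orbits to `K`-orbits and hence the
`K`-finite dual `Ṽ ⊆ V*` onto `W̃ ⊆ W*` (`dualEquiv_mem_carrier`, `map_carrier_eq`); restricting gives **`GKEquiv.KfinEquiv e : Ṽ ≅ W̃`**, a
`(𝔤, K)`-equivalence for the restricted data `(Kfin, lieFin)` of `GKContragredient`, and `areGKEquivalent_Kfin` — the contragredient
`V ↦ Ṽ` is well defined on equivalence classes (Borel–Wallach's `Π(G)`, [BorelWallach2000, 0 §2.5]; Knapp–Vogan's contragredient FUNCTOR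
`V ↦ V^c` on `𝒞(𝔤, K)`, [KnappVogan1995, §II.3 after (2.42)] — here only on isomorphisms).

## What is formalised

`dualEquiv_mem_carrier` (`ℓ ∈ Ṽ ⟹ ℓ ∘ e⁻¹ ∈ W̃`), `map_carrier_eq` (`(ℓ ↦ ℓ ∘ e⁻¹)(Ṽ) = W̃`), **`GKEquiv.KfinEquiv`** (+ `coe_KfinEquiv_apply`),
**`areGKEquivalent_Kfin`**.  NOT here: non-invertible `(𝔤, K)`-maps (the transpose of a `(𝔤, K)`-map preserves `K`-finite vectors too;
not needed downstream).

## References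

* A. Borel, N. Wallach, *Continuous Cohomology, Discrete Subgroups, and Representations of Reductive Groups*, 2nd ed., Math. Surveys
  Monogr. 67, AMS (2000), 0 §2.5. [BorelWallach2000]
* A. W. Knapp, D. A. Vogan, *Cohomological Induction and Unitary Representations*, Princeton Math. Ser. 45 (1995), §II.3 (2.42) ff., 2).
  [KnappVogan1995]
-/

noncomputable section

namespace Literature.NumberTheory.Automorphic

open Module

-- Mathlib idiom (as in `GKModules`, `GKContragredient`): commutator bracket on `Module.End`
attribute [local instance 100] LieRing.ofAssociativeRing

variable {A : Type*} [NormedCommRing A] [NormedAlgebra ℝ A] [NormedAlgebra ℚ A] [CompleteSpace A]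
  [StarRing A] {N : Type*} [Fintype N] [DecidableEq N] (G : RealMatrixGroup A N)
  {V : Type*} [AddCommGroup V] [Module ℂ V] {ρK : Representation ℂ G.maximalCompact V} {ρ𝔤 : G.lie →ₗ⁅ℝ⁆ Module.End ℂ V}
  {W : Type*} [AddCommGroup W] [Module ℂ W] {σK : Representation ℂ G.maximalCompact W} {σ𝔤 : G.lie →ₗ⁅ℝ⁆ Module.End ℂ W}

namespace GKDual

/-- **`ℓ ↦ ℓ ∘ e⁻¹` carries `K`-finite functionals to `K`-finite functionals**: the `K`-orbit of `ℓ ∘ e⁻¹` is the image of the `K`-orbit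
of `ℓ` (`GKEquiv.dualEquiv` intertwines the contragredient `K`-actions). [cite: BorelWallach2000, 0 §2.5] [cite: KnappVogan1995, §II.3 (2.42) ff., 2)] -/
theorem dualEquiv_mem_carrier (e : GKEquiv ρK ρ𝔤 σK σ𝔤) {ℓ : Dual ℂ V} (hℓ : ℓ ∈ carrier G ρK) :
    (e.dualEquiv G).toLinearEquiv ℓ ∈ carrier G σK := by
  rw [mem_kFiniteVectors_iff] at hℓ ⊢
  have hfun : (fun k : G.maximalCompact ↦ σK.dual k ((e.dualEquiv G).toLinearEquiv ℓ)) =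
      (e.dualEquiv G).toLinearEquiv.toLinearMap ∘ fun k ↦ ρK.dual k ℓ :=
    funext fun k => ((e.dualEquiv G).map_ρK k ℓ).symm
  rw [hfun, Set.range_comp, ← Submodule.map_span]
  exact Module.Finite.map _ _

/-- **`(ℓ ↦ ℓ ∘ e⁻¹)(Ṽ) = W̃`.** [cite: BorelWallach2000, 0 §2.5] -/
theorem map_carrier_eq (e : GKEquiv ρK ρ𝔤 σK σ𝔤) :
    (carrier G ρK).map ((e.dualEquiv G).toLinearEquiv : Dual ℂ V →ₗ[ℂ] Dual ℂ W) = carrier G σK := by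
  refine le_antisymm ?_ fun ℓ' hℓ' => ?_
  · rintro _ ⟨ℓ, hℓ, rfl⟩
    exact dualEquiv_mem_carrier G e hℓ
  · -- `ℓ′ = (ℓ′ ∘ e) ∘ e⁻¹` with `ℓ′ ∘ e` `K`-finite (same argument for the inverse transpose)
    refine ⟨(e.dualEquiv G).toLinearEquiv.symm ℓ', ?_, LinearEquiv.apply_symm_apply _ _⟩
    rw [SetLike.mem_coe, mem_kFiniteVectors_iff]
    rw [mem_kFiniteVectors_iff] at hℓ'
    have hfun : (fun k : G.maximalCompact ↦ ρK.dual k ((e.dualEquiv G).toLinearEquiv.symm ℓ')) =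
        (e.dualEquiv G).toLinearEquiv.symm.toLinearMap ∘ fun k ↦ σK.dual k ℓ' := by
      funext k
      apply (e.dualEquiv G).toLinearEquiv.injective
      rw [Function.comp_apply, LinearEquiv.coe_coe, LinearEquiv.apply_symm_apply, (e.dualEquiv G).map_ρK,
        LinearEquiv.apply_symm_apply]
    rw [hfun, Set.range_comp, ← Submodule.map_span]
    exact Module.Finite.map _ _

variable [Module.Finite ℝ G.lie]

/-- **`V ≅ W ⟹ Ṽ ≅ W̃`**: the `(𝔤, K)`-equivalence of `K`-finite contragredients induced by a `(𝔤, K)`-equivalence `e`, `ℓ ↦ ℓ ∘ e⁻¹` on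
`Ṽ`, for the restricted data `(Kfin, lieFin)`. [cite: BorelWallach2000, 0 §2.5] [cite: KnappVogan1995, §II.3 (2.42) ff., 2)] -/
def _root_.Literature.NumberTheory.Automorphic.GKEquiv.KfinEquiv (e : GKEquiv ρK ρ𝔤 σK σ𝔤)
    (had : ∀ (k : G.maximalCompact) (X : G.lie),
      ρK k ∘ₗ ρ𝔤 X ∘ₗ ρK k⁻¹ = ρ𝔤 (G.Ad (Subgroup.inclusion G.maximalCompact_le_carrier k) X))
    (had' : ∀ (k : G.maximalCompact) (X : G.lie),
      σK k ∘ₗ σ𝔤 X ∘ₗ σK k⁻¹ = σ𝔤 (G.Ad (Subgroup.inclusion G.maximalCompact_le_carrier k) X)) :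
    GKEquiv (Kfin G ρK) (lieFin G ρK ρ𝔤 had) (Kfin G σK) (lieFin G σK σ𝔤 had') where
  toLinearEquiv := ((e.dualEquiv G).toLinearEquiv.submoduleMap (carrier G ρK)).trans (LinearEquiv.ofEq _ _ (map_carrier_eq G e))
  map_ρK k ℓ := Subtype.ext ((e.dualEquiv G).map_ρK k (ℓ : Dual ℂ V))
  map_ρ𝔤 X ℓ := Subtype.ext ((e.dualEquiv G).map_ρ𝔤 X (ℓ : Dual ℂ V))

/-- `e.KfinEquiv ℓ = ℓ ∘ e⁻¹` on functionals. [cite: BorelWallach2000, 0 §2.5] -/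
@[simp] theorem coe_KfinEquiv_apply (e : GKEquiv ρK ρ𝔤 σK σ𝔤) (had had') (ℓ : carrier G ρK) :
    (((e.KfinEquiv G had had').toLinearEquiv ℓ : carrier G σK) : Dual ℂ W) = (e.dualEquiv G).toLinearEquiv (ℓ : Dual ℂ V) := rfl

/-- `(e.KfinEquiv ℓ)(w) = ℓ(e⁻¹ w)`. [cite: BorelWallach2000, 0 §2.5] -/
theorem KfinEquiv_apply_apply (e : GKEquiv ρK ρ𝔤 σK σ𝔤) (had had') (ℓ : carrier G ρK) (w : W) :
    (((e.KfinEquiv G had had').toLinearEquiv ℓ : carrier G σK) : Dual ℂ W) w = (ℓ : Dual ℂ V) (e.toLinearEquiv.symm w) := rfl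

variable [StarModule ℝ A] [ContinuousStar A]

/-- **Equivalent `(𝔤, K)`-modules have equivalent contragredients** (the contragredient is well defined on `Π(G)`).
[cite: BorelWallach2000, 0 §2.5] [cite: KnappVogan1995, §II.3 (2.42) ff., 2)] -/
theorem areGKEquivalent_Kfin (hV : IsGKModule G ρK ρ𝔤) (hW : IsGKModule G σK σ𝔤) (h : AreGKEquivalent ρK ρ𝔤 σK σ𝔤) :
    AreGKEquivalent (Kfin G ρK) (lieFin G ρK ρ𝔤 hV.ad_compat) (Kfin G σK) (lieFin G σK σ𝔤 hW.ad_compat) :=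
  h.elim fun e => ⟨e.KfinEquiv G hV.ad_compat hW.ad_compat⟩

end GKDual

end Literature.NumberTheory.Automorphic
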